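import Mathlib
import Literature.Analysis.Calculus.MixedPartials

/-!
# The fold (saddle-node) bifurcation of zeros: birth of two simple zeros

Analysis/Calculus proof file (Mathlib + `MixedPartials` for the partial derivatives along the
coordinate lines; theorems only, no definitions, no named facts).

Let `f : ℝ → ℝ → ℝ`, `(t, x) ↦ f t x`, be `C²` near the origin with
`f 0 0 = 0`, `∂ₓ f (0, 0) = 0` (a degenerate zero of `f 0` at `x = 0`), the **non-degeneracy**
condition `∂ₓₓ f (0, 0) ≠ 0` and the **transversality** condition `∂ₜ f (0, 0) ≠ 0` — the
conditions (A.1), (A.2) of the generic fold bifurcation, Kuznetsov (2023), §3.3, Thm. 3.1. Then in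
a fixed window `(-ρ, ρ)` of `x` and for small times `t`, the zero set of `f t` undergoes the fold
bifurcation `β ± η² = 0` (loc. cit., §3.2, Fig. 3.2 and §3.3, Fig. 3.4): normalising the signs to
`∂ₓₓ f (0, 0) > 0`, `∂ₜ f (0, 0) < 0` (`fold_birth_of_two_zeros`),

* at `t = 0` the only zero of `f 0` in the window is the degenerate zero `x = 0` (`f 0 > 0`
  elsewhere in the window);
* for small `t < 0`, `f t > 0` on the whole window (no zeros);
* for small `t > 0`, `f t` has exactly two zeros `z₁ < 0 < z₂` in the window, both simple, with
  `∂ₓ f t z₁ < 0 < ∂ₓ f t z₂`.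

The time-reversed statement (`∂ₜ f (0, 0) > 0`: two simple zeros for small `t < 0` dying at
`t = 0`) is `fold_death_of_two_zeros`; `fold_birth_of_two_zeros_le` chooses the window inside a
prescribed one; the case `∂ₓₓ f (0, 0) < 0` is reduced to these by
`f ↦ -f`. The proof is the elementary one: `∂ₓ f t` is strictly increasing in `x` on a box around
the origin (`∂ₓₓ f > 0` there) and `f t x` is strictly decreasing in `t` (`∂ₜ f < 0`), so `f 0 > 0`
off `x = 0`, `f t > f 0 ≥ 0` for `t < 0`, and for `t > 0` the intermediate value theorem on
`[-ρ, 0]` and `[0, ρ]` (`f t 0 < 0 < f t (±ρ)`) produces the two zeros, whose simplicity and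
uniqueness follow from the monotonicity of `∂ₓ f t` and the mean value theorem.

This is the local model, in adapted coordinates, of the second Reidemeister move of a generic
isotopy of knot diagrams (two arcs, graphs over a common axis, whose difference of heights is `f`):
a quadratic tangency at `t = 0` through which a bigon of two transverse crossings of opposite
local slopes is born (used towards `Literature.Topology.FourManifolds.Knot.reidemeisterR`).

## References

* Yu. A. Kuznetsov, *Elements of Applied Bifurcation Theory*, 4th ed., Applied Mathematical
  Sciences 112, Springer (2023), §3.2 (the normal form `ẋ = α + x²` of the fold bifurcation: two
  equilibria for `α < 0`, none for `α > 0`), §3.3, Thm. 3.1 (generic fold: `f = f_x = 0`,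
  (A.1) `f_xx ≠ 0`, (A.2) `f_α ≠ 0`). [Kuznetsov2023]
-/

noncomputable section

open scoped Topology
open Filter Set Function

namespace Literature.Analysis.Calculus

/-! ### The open box around the origin -/

section Box

variable {t x : ℝ}

/-- Points of the open box `|t| < r`, `|x| < r` are `r`-close to the origin of `ℝ × ℝ`.
[folklore] -/
theorem dist_mk_zero_lt {r : ℝ} (ht : |t| < r) (hx : |x| < r) :
    dist ((t, x) : ℝ × ℝ) (0, 0) < r := by
  rw [Prod.dist_eq, Real.dist_eq, Real.dist_eq, sub_zero, sub_zero]
  exact max_lt ht hx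

end Box

/-! ### The fold bifurcation -/

/-- **Birth of two simple zeros through a fold (saddle-node bifurcation of zeros).** Let
`f : ℝ → ℝ → ℝ` be `C²` near the origin (as a function of `(t, x)`), with `f 0 0 = 0`,
`∂ₓ f (0, 0) = 0`, `∂ₓₓ f (0, 0) > 0` and `∂ₜ f (0, 0) < 0`. Then there are a window `(-ρ, ρ)` and a
time `δ > 0` such that: `f 0 x > 0` for `x ≠ 0` in the window; `f t > 0` on the window for
`t ∈ (-δ, 0)`; and for `t ∈ (0, δ)` the zeros of `f t` in the window are exactly two points
`z₁ < 0 < z₂`, both simple, with `∂ₓ f t z₁ < 0 < ∂ₓ f t z₂`. Kuznetsov (2023), §3.3, Thm. 3.1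
with §3.2 (conditions (A.1) `f_xx ≠ 0`, (A.2) `f_α ≠ 0`; normal form `α ± x²`).
[cite: Kuznetsov2023, §3.3 Thm. 3.1] -/
theorem fold_birth_of_two_zeros {f : ℝ → ℝ → ℝ} (hf : ContDiffAt ℝ 2 (uncurry f) (0, 0))
    (h0 : f 0 0 = 0) (hx : deriv (f 0) 0 = 0) (hxx : 0 < deriv (deriv (f 0)) 0)
    (ht : deriv (fun t ↦ f t 0) 0 < 0) :
    ∃ ρ > 0, ∃ δ > 0,
      (∀ x ∈ Ioo (-ρ) ρ, x ≠ 0 → 0 < f 0 x) ∧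
      (∀ t ∈ Ioo (-δ) 0, ∀ x ∈ Ioo (-ρ) ρ, 0 < f t x) ∧
      ∀ t ∈ Ioo 0 δ, ∃ z₁ z₂ : ℝ, -ρ < z₁ ∧ z₁ < 0 ∧ 0 < z₂ ∧ z₂ < ρ ∧
        f t z₁ = 0 ∧ f t z₂ = 0 ∧ deriv (f t) z₁ < 0 ∧ 0 < deriv (f t) z₂ ∧
        ∀ x ∈ Ioo (-ρ) ρ, f t x = 0 → x = z₁ ∨ x = z₂ := by
  -- the function of two variables and its partial derivatives
  set F : ℝ × ℝ → ℝ := uncurry f with hF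
  have hFf : ∀ t x, F (t, x) = f t x := fun _ _ ↦ rfl
  set g : ℝ × ℝ → ℝ := fun p ↦ fderiv ℝ F p (0, 1) with hg
  set k : ℝ × ℝ → ℝ := fun p ↦ fderiv ℝ F p (1, 0) with hk
  set g' : ℝ × ℝ → ℝ := fun p ↦ fderiv ℝ g p (0, 1) with hg'
  have hgc : ContDiffAt ℝ 1 g (0, 0) :=
    (hf.fderiv_right (m := 1) (by norm_num)).clm_apply contDiffAt_const
  have hg'c : ContinuousAt g' (0, 0) := (hgc.continuousAt_fderiv one_ne_zero).clm_apply
    continuousAt_const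
  have hkc : ContinuousAt k (0, 0) := (hf.continuousAt_fderiv two_ne_zero).clm_apply
    continuousAt_const
  -- the hypotheses in terms of `g`, `g'`, `k`
  have hF0 : DifferentiableAt ℝ F (0, 0) := hf.differentiableAt two_ne_zero
  have hg0 : g (0, 0) = 0 := by
    have h := (hasDerivAt_curry_right hF0).deriv
    change deriv (f 0) 0 = g (0, 0) at h
    rw [← h, hx]
  have hk0 : k (0, 0) < 0 := by
    have h := (hasDerivAt_curry_left hF0).deriv
    change deriv (fun τ ↦ f τ 0) 0 = k (0, 0) at h
    rw [← h]
    exact ht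
  have hg'0 : 0 < g' (0, 0) := by
    -- `x ↦ deriv (f 0) x` agrees with `x ↦ g (0, x)` near `0`
    have h1 : ∀ᶠ p in 𝓝 ((0 : ℝ), (0 : ℝ)), ContDiffAt ℝ 2 F p := hf.eventually (by simp)
    have h2 : deriv (f 0) =ᶠ[𝓝 (0 : ℝ)] fun x ↦ g (0, x) := by
      have hc : Continuous fun x : ℝ ↦ ((0 : ℝ), x) := continuous_const.prodMk continuous_id
      filter_upwards [hc.continuousAt.eventually h1] with x hx
      have h := (hasDerivAt_curry_right (hx.differentiableAt two_ne_zero)).deriv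
      change deriv (f 0) x = g (0, x) at h
      exact h
    have h3 : deriv (fun x ↦ g (0, x)) 0 = g' (0, 0) :=
      (hasDerivAt_curry_right (hgc.differentiableAt one_ne_zero)).deriv
    rw [← h3, ← h2.deriv_eq]
    exact hxx
  -- a box `|t| < r`, `|x| < r` on which `F` is `C²`, `g` is `C¹`, `g' > 0` and `k < 0`
  obtain ⟨r, hr, hbox⟩ : ∃ r > 0, ∀ t x : ℝ, |t| < r → |x| < r →
      ContDiffAt ℝ 2 F (t, x) ∧ ContDiffAt ℝ 1 g (t, x) ∧ 0 < g' (t, x) ∧ k (t, x) < 0 := by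
    have h1 : ∀ᶠ p in 𝓝 ((0 : ℝ), (0 : ℝ)), ContDiffAt ℝ 2 F p := hf.eventually (by simp)
    have h2 : ∀ᶠ p in 𝓝 ((0 : ℝ), (0 : ℝ)), ContDiffAt ℝ 1 g p := hgc.eventually (by simp)
    have h3 : ∀ᶠ p in 𝓝 ((0 : ℝ), (0 : ℝ)), 0 < g' p := hg'c.eventually_const_lt hg'0
    have h4 : ∀ᶠ p in 𝓝 ((0 : ℝ), (0 : ℝ)), k p < 0 := hkc.eventually_lt_const hk0
    obtain ⟨r, hr, h⟩ := Metric.eventually_nhds_iff.1 (h1.and (h2.and (h3.and h4)))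
    exact ⟨r, hr, fun t x ht hx ↦ h (dist_mk_zero_lt ht hx)⟩
  -- derivatives along the coordinate lines inside the box
  have hdx : ∀ t x, |t| < r → |x| < r → HasDerivAt (f t) (g (t, x)) x := fun t x ht hx ↦
    hasDerivAt_curry_right ((hbox t x ht hx).1.differentiableAt two_ne_zero)
  have hdt : ∀ t x, |t| < r → |x| < r → HasDerivAt (fun τ ↦ f τ x) (k (t, x)) t :=
    fun t x ht hx ↦ hasDerivAt_curry_left ((hbox t x ht hx).1.differentiableAt two_ne_zero)
  have hdg : ∀ t x, |t| < r → |x| < r → HasDerivAt (fun s ↦ g (t, s)) (g' (t, x)) x :=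
    fun t x ht hx ↦ hasDerivAt_curry_right ((hbox t x ht hx).2.1.differentiableAt one_ne_zero)
  have habs : ∀ {a b y : ℝ}, -r ≤ a → b ≤ r → y ∈ Ioo a b → |y| < r := fun ha hb hy ↦
    abs_lt.2 ⟨by linarith [hy.1], by linarith [hy.2]⟩
  have habs' : ∀ {a b y : ℝ}, -r < a → b < r → y ∈ Icc a b → |y| < r := fun ha hb hy ↦
    abs_lt.2 ⟨by linarith [hy.1], by linarith [hy.2]⟩
  -- `x ↦ g (t, x)` is strictly increasing on `(-r, r)`
  have hgmono : ∀ t, |t| < r → StrictMonoOn (fun s ↦ g (t, s)) (Ioo (-r) r) := by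
    intro t ht
    refine strictMonoOn_of_deriv_pos (convex_Ioo _ _)
      (fun x hx ↦ (hdg t x ht (habs le_rfl le_rfl hx)).continuousAt.continuousWithinAt) ?_
    intro x hx
    rw [interior_Ioo] at hx
    rw [(hdg t x ht (habs le_rfl le_rfl hx)).deriv]
    exact (hbox t x ht (habs le_rfl le_rfl hx)).2.2.1
  -- `t ↦ f t x` is strictly decreasing on `(-r, r)`
  have hfanti : ∀ x, |x| < r → StrictAntiOn (fun τ ↦ f τ x) (Ioo (-r) r) := by
    intro x hx
    refine strictAntiOn_of_deriv_neg (convex_Ioo _ _)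
      (fun t ht ↦ (hdt t x (habs le_rfl le_rfl ht) hx).continuousAt.continuousWithinAt) ?_
    intro t ht
    rw [interior_Ioo] at ht
    rw [(hdt t x (habs le_rfl le_rfl ht) hx).deriv]
    exact (hbox t x (habs le_rfl le_rfl ht) hx).2.2.2
  -- `f t` is strictly monotone on closed intervals of the box where `g` has a sign
  have hmono : ∀ t a b, |t| < r → -r < a → b < r → (∀ y ∈ Ioo a b, 0 < g (t, y)) →
      StrictMonoOn (f t) (Icc a b) := by
    intro t a b ht ha hb hpos
    refine strictMonoOn_of_deriv_pos (convex_Icc _ _)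
      (fun x hx ↦ (hdx t x ht (habs' ha hb hx)).continuousAt.continuousWithinAt) ?_
    intro x hx
    rw [interior_Icc] at hx
    rw [(hdx t x ht (habs ha.le hb.le hx)).deriv]
    exact hpos x hx
  have hanti : ∀ t a b, |t| < r → -r < a → b < r → (∀ y ∈ Ioo a b, g (t, y) < 0) →
      StrictAntiOn (f t) (Icc a b) := by
    intro t a b ht ha hb hneg
    refine strictAntiOn_of_deriv_neg (convex_Icc _ _)
      (fun x hx ↦ (hdx t x ht (habs' ha hb hx)).continuousAt.continuousWithinAt) ?_
    intro x hx
    rw [interior_Icc] at hx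
    rw [(hdx t x ht (habs ha.le hb.le hx)).deriv]
    exact hneg x hx
  have hr0 : |(0 : ℝ)| < r := by rwa [abs_zero]
  -- at `t = 0`: `g (0, x)` has the sign of `x`, so `f 0 > 0` off `x = 0`
  have hg0x : ∀ x ∈ Ioo (-r) r, (0 < x → 0 < g (0, x)) ∧ (x < 0 → g (0, x) < 0) := by
    intro x hx
    have h0mem : (0 : ℝ) ∈ Ioo (-r) r := ⟨by linarith, hr⟩
    constructor
    · intro h
      have h' : g (0, 0) < g (0, x) := hgmono 0 hr0 h0mem hx h
      rwa [hg0] at h'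
    · intro h
      have h' : g (0, x) < g (0, 0) := hgmono 0 hr0 hx h0mem h
      rwa [hg0] at h'
  have hf0pos : ∀ x ∈ Ioo (-r) r, x ≠ 0 → 0 < f 0 x := by
    intro x hx hx0
    rcases lt_or_gt_of_ne hx0 with h | h
    · -- `x < 0`: `f 0` is strictly decreasing on `[x, 0]`
      have := hanti 0 x 0 hr0 hx.1 hr (fun y hy ↦ (hg0x y ⟨hx.1.trans hy.1, hy.2.trans hr⟩).2
        hy.2) (left_mem_Icc.2 h.le) (right_mem_Icc.2 h.le) h
      rwa [h0] at this
    · -- `0 < x`: `f 0` is strictly increasing on `[0, x]`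
      have := hmono 0 0 x hr0 (by linarith) hx.2 (fun y hy ↦ (hg0x y ⟨by linarith [hy.1],
        hy.2.trans hx.2⟩).1 hy.1) (left_mem_Icc.2 h.le) (right_mem_Icc.2 h.le) h
      rwa [h0] at this
  -- the window `ρ = r / 2` and a time `δ ≤ ρ` with `f t (±ρ) > 0` for `|t| < δ`
  set ρ : ℝ := r / 2 with hρ
  have hρ0 : 0 < ρ := by positivity
  have hρr : ρ < r := by rw [hρ]; linarith
  have hρabs : |ρ| < r := by rwa [abs_of_pos hρ0]
  have hρabs' : |(-ρ)| < r := by rwa [abs_neg]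
  have hρmem : ρ ∈ Ioo (-r) r := ⟨by linarith, hρr⟩
  have hρmem' : -ρ ∈ Ioo (-r) r := ⟨by linarith, by linarith⟩
  obtain ⟨δ, hδ, hδρ, hends⟩ : ∃ δ > 0, δ ≤ ρ ∧ ∀ t, |t| < δ → 0 < f t ρ ∧ 0 < f t (-ρ) := by
    have h1 : ∀ᶠ t in 𝓝 (0 : ℝ), 0 < f t ρ :=
      (hdt 0 ρ hr0 hρabs).continuousAt.eventually_const_lt (hf0pos ρ hρmem hρ0.ne')
    have h2 : ∀ᶠ t in 𝓝 (0 : ℝ), 0 < f t (-ρ) :=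
      (hdt 0 (-ρ) hr0 hρabs').continuousAt.eventually_const_lt
        (hf0pos (-ρ) hρmem' (neg_ne_zero.2 hρ0.ne'))
    obtain ⟨δ, hδ, h⟩ := Metric.eventually_nhds_iff.1 (h1.and h2)
    refine ⟨min δ ρ, lt_min hδ hρ0, min_le_right _ _, fun t ht ↦ h ?_⟩
    rw [Real.dist_eq, sub_zero]
    exact ht.trans_le (min_le_left _ _)
  have hδr : δ < r := hδρ.trans_lt hρr
  refine ⟨ρ, hρ0, δ, hδ, fun x hx hx0 ↦ hf0pos x ⟨by linarith [hx.1], hx.2.trans hρr⟩ hx0,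
    fun t ht x hx ↦ ?_, fun t ht ↦ ?_⟩
  · -- `t < 0`: `f t x > f 0 x ≥ 0`
    have htabs : |t| < r := abs_lt.2 ⟨by linarith [ht.1], by linarith [ht.2]⟩
    have hxr : x ∈ Ioo (-r) r := ⟨by linarith [hx.1], hx.2.trans hρr⟩
    have h1 : f 0 x < f t x :=
      hfanti x (habs le_rfl le_rfl hxr) ⟨by linarith [ht.1], by linarith [ht.2]⟩ ⟨by linarith, hr⟩
        ht.2
    rcases eq_or_ne x 0 with rfl | hx0
    · rwa [h0] at h1
    · exact (hf0pos x hxr hx0).trans h1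
  · -- `t > 0`: two simple zeros
    have htabs : |t| < r := abs_lt.2 ⟨by linarith [ht.1], ht.2.trans hδr⟩
    have hft0 : f t 0 < 0 := by
      have h' : f t 0 < f 0 0 := hfanti 0 hr0 ⟨by linarith, hr⟩ ⟨by linarith [ht.1], ht.2.trans hδr⟩ ht.1
      rwa [h0] at h'
    obtain ⟨hρpos, hρneg⟩ := hends t (abs_lt.2 ⟨by linarith [ht.1], ht.2⟩)
    have hcont : ∀ a b, -r < a → b < r → ContinuousOn (f t) (Icc a b) := fun a b ha hb x hx ↦
      (hdx t x htabs (habs' ha hb hx)).continuousAt.continuousWithinAt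
    -- the zero `z₂ ∈ (0, ρ)`
    obtain ⟨z₂, hz₂mem, hz₂⟩ : ∃ z₂ ∈ Icc 0 ρ, f t z₂ = 0 :=
      intermediate_value_Icc hρ0.le (hcont 0 ρ (by linarith) hρr) ⟨hft0.le, hρpos.le⟩
    have hz₂0 : 0 < z₂ := hz₂mem.1.lt_of_ne (by rintro rfl; exact hft0.ne hz₂)
    have hz₂ρ : z₂ < ρ := hz₂mem.2.lt_of_ne (by rintro rfl; exact hρpos.ne' hz₂)
    -- the zero `z₁ ∈ (-ρ, 0)`
    obtain ⟨z₁, hz₁mem, hz₁⟩ : ∃ z₁ ∈ Icc (-ρ) 0, f t z₁ = 0 :=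
      intermediate_value_Icc' (by linarith) (hcont (-ρ) 0 (by linarith) hr) ⟨hft0.le, hρneg.le⟩
    have hz₁0 : z₁ < 0 := hz₁mem.2.lt_of_ne (by rintro h; rw [h] at hz₁; exact hft0.ne hz₁)
    have hz₁ρ : -ρ < z₁ := hz₁mem.1.lt_of_ne (by rintro h; rw [← h] at hz₁; exact hρneg.ne' hz₁)
    have hz₁r : |z₁| < r := abs_lt.2 ⟨by linarith, by linarith⟩
    have hz₂r : |z₂| < r := abs_lt.2 ⟨by linarith, by linarith⟩
    -- slopes at the zeros, by the mean value theorem and the monotonicity of `g (t, ·)`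
    have hslope₂ : 0 < g (t, z₂) := by
      obtain ⟨c, hc, hcg⟩ := exists_hasDerivAt_eq_slope (f t) (fun s ↦ g (t, s)) hz₂0
        (hcont 0 z₂ (by linarith) (by linarith))
        (fun y hy ↦ hdx t y htabs (abs_lt.2 ⟨by linarith [hy.1], by linarith [hy.2]⟩))
      have hcpos : 0 < g (t, c) := by
        rw [hcg, hz₂, sub_zero, zero_sub]
        exact div_pos (neg_pos.2 hft0) hz₂0
      exact hcpos.trans (hgmono t htabs ⟨by linarith [hc.1], by linarith [hc.2]⟩
        ⟨by linarith, by linarith⟩ hc.2)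
    
    have hslope₁ : g (t, z₁) < 0 := by
      obtain ⟨c, hc, hcg⟩ := exists_hasDerivAt_eq_slope (f t) (fun s ↦ g (t, s)) hz₁0
        (hcont z₁ 0 (by linarith) hr)
        (fun y hy ↦ hdx t y htabs (abs_lt.2 ⟨by linarith [hy.1], by linarith [hy.2]⟩))
      have hcneg : g (t, c) < 0 := by
        rw [hcg, hz₁, sub_zero, zero_sub]
        exact div_neg_of_neg_of_pos hft0 (neg_pos.2 hz₁0)
      exact (hgmono t htabs ⟨by linarith, by linarith⟩ ⟨by linarith [hc.1], by linarith [hc.2]⟩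
        hc.1).trans hcneg
    -- hence `g (t, ·) < 0` to the left of `z₁` and `> 0` to the right of `z₂`
    have hgneg : ∀ y ∈ Ioo (-r) z₁, g (t, y) < 0 := fun y hy ↦
      (hgmono t htabs ⟨hy.1, by linarith [hy.2]⟩ ⟨by linarith, by linarith⟩ hy.2).trans hslope₁
    have hgpos : ∀ y ∈ Ioo z₂ r, 0 < g (t, y) := fun y hy ↦
      hslope₂.trans (hgmono t htabs ⟨by linarith, by linarith⟩ ⟨by linarith [hy.1], hy.2⟩ hy.1)
    refine ⟨z₁, z₂, hz₁ρ, hz₁0, hz₂0, hz₂ρ, hz₁, hz₂, ?_, ?_, fun x hx hfx ↦ ?_⟩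
    · rwa [(hdx t z₁ htabs hz₁r).deriv]
    · rwa [(hdx t z₂ htabs hz₂r).deriv]
    · -- uniqueness: `f t` is strictly monotone away from the zeros, negative between them
      have hxr : -r < x ∧ x < r := ⟨by linarith [hx.1], by linarith [hx.2]⟩
      by_contra hne
      obtain ⟨hne₁, hne₂⟩ := not_or.1 hne
      rcases lt_or_gt_of_ne hne₁ with h₁ | h₁
      · -- `x < z₁`: `f t` is strictly decreasing on `[x, z₁]`
        have h' := hanti t x z₁ htabs hxr.1 (by linarith)
          (fun y hy ↦ hgneg y ⟨by linarith [hy.1], hy.2⟩) (left_mem_Icc.2 h₁.le)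
          (right_mem_Icc.2 h₁.le) h₁
        rw [hz₁, hfx] at h'
        exact lt_irrefl _ h'
      rcases lt_or_gt_of_ne hne₂ with h₂ | h₂
      · -- `z₁ < x < z₂`: `f t x < 0`
        rcases le_or_gt (g (t, x)) 0 with hgx | hgx
        · have h' := hanti t z₁ x htabs (by linarith) hxr.2
            (fun y hy ↦ (hgmono t htabs ⟨by linarith [hy.1], by linarith [hy.2]⟩ ⟨hxr.1, hxr.2⟩
              hy.2).trans_le hgx) (left_mem_Icc.2 h₁.le) (right_mem_Icc.2 h₁.le) h₁
          rw [hz₁, hfx] at h'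
          exact lt_irrefl _ h'
        · have h' := hmono t x z₂ htabs hxr.1 (by linarith)
            (fun y hy ↦ hgx.trans (hgmono t htabs ⟨hxr.1, hxr.2⟩ ⟨by linarith [hy.1],
              by linarith [hy.2]⟩ hy.1)) (left_mem_Icc.2 h₂.le) (right_mem_Icc.2 h₂.le) h₂
          rw [hz₂, hfx] at h'
          exact lt_irrefl _ h'
      · -- `z₂ < x`: `f t` is strictly increasing on `[z₂, x]`
        have h' := hmono t z₂ x htabs (by linarith) hxr.2
          (fun y hy ↦ hgpos y ⟨hy.1, by linarith [hy.2]⟩) (left_mem_Icc.2 h₂.le)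
          (right_mem_Icc.2 h₂.le) h₂
        rw [hz₂, hfx] at h'
        exact lt_irrefl _ h'

/-- **Death of two simple zeros through a fold**, the time-reversed form of
`fold_birth_of_two_zeros`: with `∂ₜ f (0, 0) > 0` instead, `f t` has exactly two simple zeros
`z₁ < 0 < z₂` in the window for `t ∈ (-δ, 0)` (`∂ₓ f t z₁ < 0 < ∂ₓ f t z₂`), the degenerate zero
`x = 0` at `t = 0`, and no zero for `t ∈ (0, δ)`. (Apply the birth statement to
`(t, x) ↦ f (-t) x`.) The cases `∂ₓₓ f (0, 0) < 0` follow by `f ↦ -f`.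
[cite: Kuznetsov2023, §3.3 Thm. 3.1] -/
theorem fold_death_of_two_zeros {f : ℝ → ℝ → ℝ} (hf : ContDiffAt ℝ 2 (uncurry f) (0, 0))
    (h0 : f 0 0 = 0) (hx : deriv (f 0) 0 = 0) (hxx : 0 < deriv (deriv (f 0)) 0)
    (ht : 0 < deriv (fun t ↦ f t 0) 0) :
    ∃ ρ > 0, ∃ δ > 0,
      (∀ x ∈ Ioo (-ρ) ρ, x ≠ 0 → 0 < f 0 x) ∧
      (∀ t ∈ Ioo 0 δ, ∀ x ∈ Ioo (-ρ) ρ, 0 < f t x) ∧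
      ∀ t ∈ Ioo (-δ) 0, ∃ z₁ z₂ : ℝ, -ρ < z₁ ∧ z₁ < 0 ∧ 0 < z₂ ∧ z₂ < ρ ∧
        f t z₁ = 0 ∧ f t z₂ = 0 ∧ deriv (f t) z₁ < 0 ∧ 0 < deriv (f t) z₂ ∧
        ∀ x ∈ Ioo (-ρ) ρ, f t x = 0 → x = z₁ ∨ x = z₂ := by
  -- the time-reversed family `fr t x = f (-t) x`
  set fr : ℝ → ℝ → ℝ := fun t ↦ f (-t) with hfr
  have hrev : ContDiffAt ℝ 2 (fun p : ℝ × ℝ ↦ ((-p.1, p.2) : ℝ × ℝ)) (0, 0) :=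
    contDiffAt_fst.neg.prodMk contDiffAt_snd
  have hf' : ContDiffAt ℝ 2 (uncurry f) ((fun p : ℝ × ℝ ↦ ((-p.1, p.2) : ℝ × ℝ)) (0, 0)) := by
    simpa using hf
  have he : uncurry fr = uncurry f ∘ fun p : ℝ × ℝ ↦ ((-p.1, p.2) : ℝ × ℝ) := by
    ext ⟨a, b⟩
    simp [hfr]
  have hfrc : ContDiffAt ℝ 2 (uncurry fr) (0, 0) := by
    rw [he]
    exact hf'.comp (0, 0) hrev
  have h0r : fr 0 0 = 0 := by rw [hfr]; simpa using h0
  have hxr : deriv (fr 0) 0 = 0 := by rw [hfr]; simpa using hx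
  have hxxr : 0 < deriv (deriv (fr 0)) 0 := by rw [hfr]; simpa using hxx
  have htr : deriv (fun t ↦ fr t 0) 0 < 0 := by
    have h := deriv_comp_neg (fun t ↦ f t 0) 0
    rw [neg_zero] at h
    rw [hfr]
    simp only
    rw [h]
    exact neg_neg_of_pos ht
  obtain ⟨ρ, hρ, δ, hδ, h1, h2, h3⟩ := fold_birth_of_two_zeros hfrc h0r hxr hxxr htr
  refine ⟨ρ, hρ, δ, hδ, fun x hx hx0 ↦ by simpa [hfr] using h1 x hx hx0, fun t ht x hx ↦ ?_,
    fun t ht ↦ ?_⟩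
  · have h := h2 (-t) ⟨by linarith [ht.2], by linarith [ht.1]⟩ x hx
    simpa [hfr] using h
  · obtain ⟨z₁, z₂, hz₁ρ, hz₁0, hz₂0, hz₂ρ, hz₁, hz₂, hd₁, hd₂, huniq⟩ :=
      h3 (-t) ⟨by linarith [ht.2], by linarith [ht.1]⟩
    simp only [hfr, neg_neg] at hz₁ hz₂ hd₁ hd₂ huniq
    exact ⟨z₁, z₂, hz₁ρ, hz₁0, hz₂0, hz₂ρ, hz₁, hz₂, hd₁, hd₂, huniq⟩


/-- **Birth of two simple zeros through a fold, in a prescribed window**: the statement of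
`fold_birth_of_two_zeros` with the window `(-ρ, ρ)` chosen inside any given `(-ρ₀, ρ₀)` (at the
cost of the time `δ`). Used to localise the new-born zeros as closely to the degenerate zero as
required. [cite: Kuznetsov2023, §3.3 Thm. 3.1] -/
theorem fold_birth_of_two_zeros_le {f : ℝ → ℝ → ℝ} (hf : ContDiffAt ℝ 2 (uncurry f) (0, 0))
    (h0 : f 0 0 = 0) (hx : deriv (f 0) 0 = 0) (hxx : 0 < deriv (deriv (f 0)) 0)
    (ht : deriv (fun t ↦ f t 0) 0 < 0) {ρ₀ : ℝ} (hρ₀ : 0 < ρ₀) :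
    ∃ ρ > 0, ρ ≤ ρ₀ ∧ ∃ δ > 0,
      (∀ x ∈ Ioo (-ρ) ρ, x ≠ 0 → 0 < f 0 x) ∧
      (∀ t ∈ Ioo (-δ) 0, ∀ x ∈ Ioo (-ρ) ρ, 0 < f t x) ∧
      ∀ t ∈ Ioo 0 δ, ∃ z₁ z₂ : ℝ, -ρ < z₁ ∧ z₁ < 0 ∧ 0 < z₂ ∧ z₂ < ρ ∧
        f t z₁ = 0 ∧ f t z₂ = 0 ∧ deriv (f t) z₁ < 0 ∧ 0 < deriv (f t) z₂ ∧
        ∀ x ∈ Ioo (-ρ) ρ, f t x = 0 → x = z₁ ∨ x = z₂ := by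
  -- the function of two variables and its partial derivatives
  set F : ℝ × ℝ → ℝ := uncurry f with hF
  have hFf : ∀ t x, F (t, x) = f t x := fun _ _ ↦ rfl
  set g : ℝ × ℝ → ℝ := fun p ↦ fderiv ℝ F p (0, 1) with hg
  set k : ℝ × ℝ → ℝ := fun p ↦ fderiv ℝ F p (1, 0) with hk
  set g' : ℝ × ℝ → ℝ := fun p ↦ fderiv ℝ g p (0, 1) with hg'
  have hgc : ContDiffAt ℝ 1 g (0, 0) :=
    (hf.fderiv_right (m := 1) (by norm_num)).clm_apply contDiffAt_const
  have hg'c : ContinuousAt g' (0, 0) := (hgc.continuousAt_fderiv one_ne_zero).clm_apply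
    continuousAt_const
  have hkc : ContinuousAt k (0, 0) := (hf.continuousAt_fderiv two_ne_zero).clm_apply
    continuousAt_const
  -- the hypotheses in terms of `g`, `g'`, `k`
  have hF0 : DifferentiableAt ℝ F (0, 0) := hf.differentiableAt two_ne_zero
  have hg0 : g (0, 0) = 0 := by
    have h := (hasDerivAt_curry_right hF0).deriv
    change deriv (f 0) 0 = g (0, 0) at h
    rw [← h, hx]
  have hk0 : k (0, 0) < 0 := by
    have h := (hasDerivAt_curry_left hF0).deriv
    change deriv (fun τ ↦ f τ 0) 0 = k (0, 0) at h
    rw [← h]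
    exact ht
  have hg'0 : 0 < g' (0, 0) := by
    -- `x ↦ deriv (f 0) x` agrees with `x ↦ g (0, x)` near `0`
    have h1 : ∀ᶠ p in 𝓝 ((0 : ℝ), (0 : ℝ)), ContDiffAt ℝ 2 F p := hf.eventually (by simp)
    have h2 : deriv (f 0) =ᶠ[𝓝 (0 : ℝ)] fun x ↦ g (0, x) := by
      have hc : Continuous fun x : ℝ ↦ ((0 : ℝ), x) := continuous_const.prodMk continuous_id
      filter_upwards [hc.continuousAt.eventually h1] with x hx
      have h := (hasDerivAt_curry_right (hx.differentiableAt two_ne_zero)).deriv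
      change deriv (f 0) x = g (0, x) at h
      exact h
    have h3 : deriv (fun x ↦ g (0, x)) 0 = g' (0, 0) :=
      (hasDerivAt_curry_right (hgc.differentiableAt one_ne_zero)).deriv
    rw [← h3, ← h2.deriv_eq]
    exact hxx
  -- a box `|t| < r`, `|x| < r` on which `F` is `C²`, `g` is `C¹`, `g' > 0` and `k < 0`
  obtain ⟨r, hr, hbox⟩ : ∃ r > 0, ∀ t x : ℝ, |t| < r → |x| < r →
      ContDiffAt ℝ 2 F (t, x) ∧ ContDiffAt ℝ 1 g (t, x) ∧ 0 < g' (t, x) ∧ k (t, x) < 0 := by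
    have h1 : ∀ᶠ p in 𝓝 ((0 : ℝ), (0 : ℝ)), ContDiffAt ℝ 2 F p := hf.eventually (by simp)
    have h2 : ∀ᶠ p in 𝓝 ((0 : ℝ), (0 : ℝ)), ContDiffAt ℝ 1 g p := hgc.eventually (by simp)
    have h3 : ∀ᶠ p in 𝓝 ((0 : ℝ), (0 : ℝ)), 0 < g' p := hg'c.eventually_const_lt hg'0
    have h4 : ∀ᶠ p in 𝓝 ((0 : ℝ), (0 : ℝ)), k p < 0 := hkc.eventually_lt_const hk0
    obtain ⟨r, hr, h⟩ := Metric.eventually_nhds_iff.1 (h1.and (h2.and (h3.and h4)))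
    exact ⟨r, hr, fun t x ht hx ↦ h (dist_mk_zero_lt ht hx)⟩
  -- derivatives along the coordinate lines inside the box
  have hdx : ∀ t x, |t| < r → |x| < r → HasDerivAt (f t) (g (t, x)) x := fun t x ht hx ↦
    hasDerivAt_curry_right ((hbox t x ht hx).1.differentiableAt two_ne_zero)
  have hdt : ∀ t x, |t| < r → |x| < r → HasDerivAt (fun τ ↦ f τ x) (k (t, x)) t :=
    fun t x ht hx ↦ hasDerivAt_curry_left ((hbox t x ht hx).1.differentiableAt two_ne_zero)
  have hdg : ∀ t x, |t| < r → |x| < r → HasDerivAt (fun s ↦ g (t, s)) (g' (t, x)) x :=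
    fun t x ht hx ↦ hasDerivAt_curry_right ((hbox t x ht hx).2.1.differentiableAt one_ne_zero)
  have habs : ∀ {a b y : ℝ}, -r ≤ a → b ≤ r → y ∈ Ioo a b → |y| < r := fun ha hb hy ↦
    abs_lt.2 ⟨by linarith [hy.1], by linarith [hy.2]⟩
  have habs' : ∀ {a b y : ℝ}, -r < a → b < r → y ∈ Icc a b → |y| < r := fun ha hb hy ↦
    abs_lt.2 ⟨by linarith [hy.1], by linarith [hy.2]⟩
  -- `x ↦ g (t, x)` is strictly increasing on `(-r, r)`
  have hgmono : ∀ t, |t| < r → StrictMonoOn (fun s ↦ g (t, s)) (Ioo (-r) r) := by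
    intro t ht
    refine strictMonoOn_of_deriv_pos (convex_Ioo _ _)
      (fun x hx ↦ (hdg t x ht (habs le_rfl le_rfl hx)).continuousAt.continuousWithinAt) ?_
    intro x hx
    rw [interior_Ioo] at hx
    rw [(hdg t x ht (habs le_rfl le_rfl hx)).deriv]
    exact (hbox t x ht (habs le_rfl le_rfl hx)).2.2.1
  -- `t ↦ f t x` is strictly decreasing on `(-r, r)`
  have hfanti : ∀ x, |x| < r → StrictAntiOn (fun τ ↦ f τ x) (Ioo (-r) r) := by
    intro x hx
    refine strictAntiOn_of_deriv_neg (convex_Ioo _ _)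
      (fun t ht ↦ (hdt t x (habs le_rfl le_rfl ht) hx).continuousAt.continuousWithinAt) ?_
    intro t ht
    rw [interior_Ioo] at ht
    rw [(hdt t x (habs le_rfl le_rfl ht) hx).deriv]
    exact (hbox t x (habs le_rfl le_rfl ht) hx).2.2.2
  -- `f t` is strictly monotone on closed intervals of the box where `g` has a sign
  have hmono : ∀ t a b, |t| < r → -r < a → b < r → (∀ y ∈ Ioo a b, 0 < g (t, y)) →
      StrictMonoOn (f t) (Icc a b) := by
    intro t a b ht ha hb hpos
    refine strictMonoOn_of_deriv_pos (convex_Icc _ _)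
      (fun x hx ↦ (hdx t x ht (habs' ha hb hx)).continuousAt.continuousWithinAt) ?_
    intro x hx
    rw [interior_Icc] at hx
    rw [(hdx t x ht (habs ha.le hb.le hx)).deriv]
    exact hpos x hx
  have hanti : ∀ t a b, |t| < r → -r < a → b < r → (∀ y ∈ Ioo a b, g (t, y) < 0) →
      StrictAntiOn (f t) (Icc a b) := by
    intro t a b ht ha hb hneg
    refine strictAntiOn_of_deriv_neg (convex_Icc _ _)
      (fun x hx ↦ (hdx t x ht (habs' ha hb hx)).continuousAt.continuousWithinAt) ?_
    intro x hx
    rw [interior_Icc] at hx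
    rw [(hdx t x ht (habs ha.le hb.le hx)).deriv]
    exact hneg x hx
  have hr0 : |(0 : ℝ)| < r := by rwa [abs_zero]
  -- at `t = 0`: `g (0, x)` has the sign of `x`, so `f 0 > 0` off `x = 0`
  have hg0x : ∀ x ∈ Ioo (-r) r, (0 < x → 0 < g (0, x)) ∧ (x < 0 → g (0, x) < 0) := by
    intro x hx
    have h0mem : (0 : ℝ) ∈ Ioo (-r) r := ⟨by linarith, hr⟩
    constructor
    · intro h
      have h' : g (0, 0) < g (0, x) := hgmono 0 hr0 h0mem hx h
      rwa [hg0] at h'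
    · intro h
      have h' : g (0, x) < g (0, 0) := hgmono 0 hr0 hx h0mem h
      rwa [hg0] at h'
  have hf0pos : ∀ x ∈ Ioo (-r) r, x ≠ 0 → 0 < f 0 x := by
    intro x hx hx0
    rcases lt_or_gt_of_ne hx0 with h | h
    · -- `x < 0`: `f 0` is strictly decreasing on `[x, 0]`
      have := hanti 0 x 0 hr0 hx.1 hr (fun y hy ↦ (hg0x y ⟨hx.1.trans hy.1, hy.2.trans hr⟩).2
        hy.2) (left_mem_Icc.2 h.le) (right_mem_Icc.2 h.le) h
      rwa [h0] at this
    · -- `0 < x`: `f 0` is strictly increasing on `[0, x]`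
      have := hmono 0 0 x hr0 (by linarith) hx.2 (fun y hy ↦ (hg0x y ⟨by linarith [hy.1],
        hy.2.trans hx.2⟩).1 hy.1) (left_mem_Icc.2 h.le) (right_mem_Icc.2 h.le) h
      rwa [h0] at this
  -- the window `ρ = r / 2` and a time `δ ≤ ρ` with `f t (±ρ) > 0` for `|t| < δ`
  set ρ : ℝ := min (r / 2) ρ₀ with hρ
  have hρ0 : 0 < ρ := lt_min (by positivity) hρ₀
  have hρr : ρ < r := (min_le_left _ _).trans_lt (by linarith)
  have hρabs : |ρ| < r := by rwa [abs_of_pos hρ0]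
  have hρabs' : |(-ρ)| < r := by rwa [abs_neg]
  have hρmem : ρ ∈ Ioo (-r) r := ⟨by linarith, hρr⟩
  have hρmem' : -ρ ∈ Ioo (-r) r := ⟨by linarith, by linarith⟩
  obtain ⟨δ, hδ, hδρ, hends⟩ : ∃ δ > 0, δ ≤ ρ ∧ ∀ t, |t| < δ → 0 < f t ρ ∧ 0 < f t (-ρ) := by
    have h1 : ∀ᶠ t in 𝓝 (0 : ℝ), 0 < f t ρ :=
      (hdt 0 ρ hr0 hρabs).continuousAt.eventually_const_lt (hf0pos ρ hρmem hρ0.ne')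
    have h2 : ∀ᶠ t in 𝓝 (0 : ℝ), 0 < f t (-ρ) :=
      (hdt 0 (-ρ) hr0 hρabs').continuousAt.eventually_const_lt
        (hf0pos (-ρ) hρmem' (neg_ne_zero.2 hρ0.ne'))
    obtain ⟨δ, hδ, h⟩ := Metric.eventually_nhds_iff.1 (h1.and h2)
    refine ⟨min δ ρ, lt_min hδ hρ0, min_le_right _ _, fun t ht ↦ h ?_⟩
    rw [Real.dist_eq, sub_zero]
    exact ht.trans_le (min_le_left _ _)
  have hδr : δ < r := hδρ.trans_lt hρr
  refine ⟨ρ, hρ0, min_le_right _ _, δ, hδ,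
    fun x hx hx0 ↦ hf0pos x ⟨by linarith [hx.1], hx.2.trans hρr⟩ hx0,
    fun t ht x hx ↦ ?_, fun t ht ↦ ?_⟩
  · -- `t < 0`: `f t x > f 0 x ≥ 0`
    have htabs : |t| < r := abs_lt.2 ⟨by linarith [ht.1], by linarith [ht.2]⟩
    have hxr : x ∈ Ioo (-r) r := ⟨by linarith [hx.1], hx.2.trans hρr⟩
    have h1 : f 0 x < f t x :=
      hfanti x (habs le_rfl le_rfl hxr) ⟨by linarith [ht.1], by linarith [ht.2]⟩ ⟨by linarith, hr⟩
        ht.2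
    rcases eq_or_ne x 0 with rfl | hx0
    · rwa [h0] at h1
    · exact (hf0pos x hxr hx0).trans h1
  · -- `t > 0`: two simple zeros
    have htabs : |t| < r := abs_lt.2 ⟨by linarith [ht.1], ht.2.trans hδr⟩
    have hft0 : f t 0 < 0 := by
      have h' : f t 0 < f 0 0 := hfanti 0 hr0 ⟨by linarith, hr⟩ ⟨by linarith [ht.1], ht.2.trans hδr⟩ ht.1
      rwa [h0] at h'
    obtain ⟨hρpos, hρneg⟩ := hends t (abs_lt.2 ⟨by linarith [ht.1], ht.2⟩)
    have hcont : ∀ a b, -r < a → b < r → ContinuousOn (f t) (Icc a b) := fun a b ha hb x hx ↦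
      (hdx t x htabs (habs' ha hb hx)).continuousAt.continuousWithinAt
    -- the zero `z₂ ∈ (0, ρ)`
    obtain ⟨z₂, hz₂mem, hz₂⟩ : ∃ z₂ ∈ Icc 0 ρ, f t z₂ = 0 :=
      intermediate_value_Icc hρ0.le (hcont 0 ρ (by linarith) hρr) ⟨hft0.le, hρpos.le⟩
    have hz₂0 : 0 < z₂ := hz₂mem.1.lt_of_ne (by rintro rfl; exact hft0.ne hz₂)
    have hz₂ρ : z₂ < ρ := hz₂mem.2.lt_of_ne (by rintro rfl; exact hρpos.ne' hz₂)
    -- the zero `z₁ ∈ (-ρ, 0)`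
    obtain ⟨z₁, hz₁mem, hz₁⟩ : ∃ z₁ ∈ Icc (-ρ) 0, f t z₁ = 0 :=
      intermediate_value_Icc' (by linarith) (hcont (-ρ) 0 (by linarith) hr) ⟨hft0.le, hρneg.le⟩
    have hz₁0 : z₁ < 0 := hz₁mem.2.lt_of_ne (by rintro h; rw [h] at hz₁; exact hft0.ne hz₁)
    have hz₁ρ : -ρ < z₁ := hz₁mem.1.lt_of_ne (by rintro h; rw [← h] at hz₁; exact hρneg.ne' hz₁)
    have hz₁r : |z₁| < r := abs_lt.2 ⟨by linarith, by linarith⟩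
    have hz₂r : |z₂| < r := abs_lt.2 ⟨by linarith, by linarith⟩
    -- slopes at the zeros, by the mean value theorem and the monotonicity of `g (t, ·)`
    have hslope₂ : 0 < g (t, z₂) := by
      obtain ⟨c, hc, hcg⟩ := exists_hasDerivAt_eq_slope (f t) (fun s ↦ g (t, s)) hz₂0
        (hcont 0 z₂ (by linarith) (by linarith))
        (fun y hy ↦ hdx t y htabs (abs_lt.2 ⟨by linarith [hy.1], by linarith [hy.2]⟩))
      have hcpos : 0 < g (t, c) := by
        rw [hcg, hz₂, sub_zero, zero_sub]
        exact div_pos (neg_pos.2 hft0) hz₂0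
      exact hcpos.trans (hgmono t htabs ⟨by linarith [hc.1], by linarith [hc.2]⟩
        ⟨by linarith, by linarith⟩ hc.2)
    
    have hslope₁ : g (t, z₁) < 0 := by
      obtain ⟨c, hc, hcg⟩ := exists_hasDerivAt_eq_slope (f t) (fun s ↦ g (t, s)) hz₁0
        (hcont z₁ 0 (by linarith) hr)
        (fun y hy ↦ hdx t y htabs (abs_lt.2 ⟨by linarith [hy.1], by linarith [hy.2]⟩))
      have hcneg : g (t, c) < 0 := by
        rw [hcg, hz₁, sub_zero, zero_sub]
        exact div_neg_of_neg_of_pos hft0 (neg_pos.2 hz₁0)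
      exact (hgmono t htabs ⟨by linarith, by linarith⟩ ⟨by linarith [hc.1], by linarith [hc.2]⟩
        hc.1).trans hcneg
    -- hence `g (t, ·) < 0` to the left of `z₁` and `> 0` to the right of `z₂`
    have hgneg : ∀ y ∈ Ioo (-r) z₁, g (t, y) < 0 := fun y hy ↦
      (hgmono t htabs ⟨hy.1, by linarith [hy.2]⟩ ⟨by linarith, by linarith⟩ hy.2).trans hslope₁
    have hgpos : ∀ y ∈ Ioo z₂ r, 0 < g (t, y) := fun y hy ↦
      hslope₂.trans (hgmono t htabs ⟨by linarith, by linarith⟩ ⟨by linarith [hy.1], hy.2⟩ hy.1)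
    refine ⟨z₁, z₂, hz₁ρ, hz₁0, hz₂0, hz₂ρ, hz₁, hz₂, ?_, ?_, fun x hx hfx ↦ ?_⟩
    · rwa [(hdx t z₁ htabs hz₁r).deriv]
    · rwa [(hdx t z₂ htabs hz₂r).deriv]
    · -- uniqueness: `f t` is strictly monotone away from the zeros, negative between them
      have hxr : -r < x ∧ x < r := ⟨by linarith [hx.1], by linarith [hx.2]⟩
      by_contra hne
      obtain ⟨hne₁, hne₂⟩ := not_or.1 hne
      rcases lt_or_gt_of_ne hne₁ with h₁ | h₁
      · -- `x < z₁`: `f t` is strictly decreasing on `[x, z₁]`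
        have h' := hanti t x z₁ htabs hxr.1 (by linarith)
          (fun y hy ↦ hgneg y ⟨by linarith [hy.1], hy.2⟩) (left_mem_Icc.2 h₁.le)
          (right_mem_Icc.2 h₁.le) h₁
        rw [hz₁, hfx] at h'
        exact lt_irrefl _ h'
      rcases lt_or_gt_of_ne hne₂ with h₂ | h₂
      · -- `z₁ < x < z₂`: `f t x < 0`
        rcases le_or_gt (g (t, x)) 0 with hgx | hgx
        · have h' := hanti t z₁ x htabs (by linarith) hxr.2
            (fun y hy ↦ (hgmono t htabs ⟨by linarith [hy.1], by linarith [hy.2]⟩ ⟨hxr.1, hxr.2⟩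
              hy.2).trans_le hgx) (left_mem_Icc.2 h₁.le) (right_mem_Icc.2 h₁.le) h₁
          rw [hz₁, hfx] at h'
          exact lt_irrefl _ h'
        · have h' := hmono t x z₂ htabs hxr.1 (by linarith)
            (fun y hy ↦ hgx.trans (hgmono t htabs ⟨hxr.1, hxr.2⟩ ⟨by linarith [hy.1],
              by linarith [hy.2]⟩ hy.1)) (left_mem_Icc.2 h₂.le) (right_mem_Icc.2 h₂.le) h₂
          rw [hz₂, hfx] at h'
          exact lt_irrefl _ h'
      · -- `z₂ < x`: `f t` is strictly increasing on `[z₂, x]`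
        have h' := hmono t z₂ x htabs (by linarith) hxr.2
          (fun y hy ↦ hgpos y ⟨hy.1, by linarith [hy.2]⟩) (left_mem_Icc.2 h₂.le)
          (right_mem_Icc.2 h₂.le) h₂
        rw [hz₂, hfx] at h'
        exact lt_irrefl _ h'

end Literature.Analysis.Calculus
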